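import Literature.MathematicalPhysics.QuantumChemistry.ThreeIndexConditionsT2Prime
import Literature.MathematicalPhysics.QuantumLattice.HubbardSzSectorLadder
import HarnessLib

/-!
# Ventures/CertifiedQuantumChemistry — Rows/T2PrimeSectorKernel.lean: the `T2′` matrix of a sector
# state has the `k` border kernel vectors of rdm-A's structural face F2

HONEST FRAMING (verbatim): certified bounds for a stated model Hamiltonian in a stated basis; not a
claim about the real molecule beyond that model.

Seat rdm-B (gen 14), zero compute; ROWS-1 courtesy file (no row, no claim node, nothing asserted about
any model); companion of `Rows/GMatrixSectorKernel.lean` (face F1). rdm-A's observation F2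
(`pub-qchem-rdm/FORMAT-qcl1-addendum-17-faces.md` §F.3, 2026-08-22): on an `(N_α, N_β)`-pinned
programme the `T2′` block has, for every orbital `p`, a kernel vector whose border component is the unit
vector at `p`, because `N̂′ = N̂_α − (N_α/N_β) N̂_β` vanishes on the sector and `A_p = a†_{pα} N̂′` lies in
the span of the cubic family `{a†_i a†_j a_k}`; consequently `T2′ ≡ T2` on the pinned rows. This file
PROVES the STATE-LEVEL form for the tree's `T2′` matrix of `ThreeIndexConditionsT2Prime.lean`
(`M(C′) + M(C″)ᵀ`, `C′ = (a†_i a†_j a_k) ⊔ (a†_l)`, `C″ = ((a†_i a†_j a_k)†) ⊔ 0`, Nakata et al. 2008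
§II.B) of ANY vector `ψ` of the `(a, b)` sector of the spinful Fock space:

* `metricMatrix_add_transpose_mulVec_eq_zero` — generic kernel criterion for a matrix of the shape
  `M(C′) + M(C″)ᵀ`: if `(Σ_J u_J C′_J†) ψ = 0` and `(Σ_J u_J C″_J)† ψ = 0` then `(M(C′) + M(C″)ᵀ) u = 0`;
* `t2Prime_mulVec_sectorKernel_up` — for `ψ` in the sector `(a, b)` and every spatial orbital `p`, the
  vector `u_p` with cubic coordinates `u_p(pα, qα, qα) = b`, `u_p(pα, qβ, qβ) = −a` (all `q`), border
  coordinate `u_p(pα) = b` and zeros elsewhere (the integer multiple `b · u_{pα}` of rdm-A's vector, so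
  that no division by `N_β` is needed) satisfies `T2′(ψ) u_p = 0`. Mechanism, as in F2's operator proof:
  `Σ_J u_J C′_J† = (b N̂_α − a N̂_β + b) a_{pα}` annihilates `ψ` because `a_{pα} ψ` lies in the sector
  `(a − 1, b)` (or vanishes when `a = 0`), and `(Σ_J u_J C″_J)† = a†_{pα} (b N̂_α − a N̂_β)` annihilates
  `ψ` because `b N̂_α − a N̂_β` does.
The spin-`β` twin (`u_p(pβ, qβ, qβ) = a`, `u_p(pβ, qα, qα) = −b`, border `a`) is
`t2Prime_mulVec_sectorKernel_down`. What is NOT here: the ROW-IMPLIED (relaxation-level) version of F2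
(kernel at every feasible point of the SDP, which needs the programme's equality rows, not a state) and
the congruence corollary `T2′ ≡ T2`; those remain rdm-A's exact instance-level statements.
Everything is PROVED (0 sorry).
-/

noncomputable section

namespace Summit.Ventures.CertifiedQuantumChemistry

open Matrix Finset
open Literature.MathematicalPhysics.QuantumLattice Literature.MathematicalPhysics.QuantumChemistry

/-! ## Generic kernel criterion -/

section Generic

variable {ι : Type*} [Fintype ι] {m : Type*} [Fintype m]

/-- **Kernel criterion for `M(C′) + M(C″)ᵀ`.** If the vector `u` makes `Σ_J u_J C′_J†` and
`(Σ_J u_J C″_J)†` annihilate `ψ`, then `u` is in the kernel of `metricMatrix C′ ψ + (metricMatrix C″ ψ)ᵀ`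
(row `I`: `⟨ψ| C′_I (Σ u_J C′_J†) |ψ⟩ + ⟨(Σ u_J C″_J)† ψ, C″_I† ψ⟩`). -/
theorem metricMatrix_add_transpose_mulVec_eq_zero (C' C'' : m → Matrix (Finset ι) (Finset ι) ℂ)
    (ψ : Fock ι) (u : m → ℂ) (hA : (∑ J, u J • (C' J)ᴴ) *ᵥ ψ = 0)
    (hB : (∑ J, u J • C'' J)ᴴ *ᵥ ψ = 0) :
    (metricMatrix C' ψ + (metricMatrix C'' ψ)ᵀ) *ᵥ u = 0 := by
  funext I
  rw [Pi.zero_apply, add_mulVec, Pi.add_apply]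
  have h1 : (metricMatrix C' ψ *ᵥ u) I = star ψ ⬝ᵥ (C' I * ∑ J, u J • (C' J)ᴴ) *ᵥ ψ := by
    change ∑ J, metricMatrix C' ψ I J * u J = _
    rw [Finset.mul_sum, Matrix.sum_mulVec, dotProduct_sum]
    refine Finset.sum_congr rfl fun J _ => ?_
    rw [Matrix.mul_smul, Matrix.smul_mulVec, dotProduct_smul, smul_eq_mul, metricMatrix, mul_comm]
  have h2 : ((metricMatrix C'' ψ)ᵀ *ᵥ u) I = star ψ ⬝ᵥ ((∑ J, u J • C'' J) * (C'' I)ᴴ) *ᵥ ψ := by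
    change ∑ J, metricMatrix C'' ψ J I * u J = _
    rw [Finset.sum_mul, Matrix.sum_mulVec, dotProduct_sum]
    refine Finset.sum_congr rfl fun J _ => ?_
    rw [Matrix.smul_mul, Matrix.smul_mulVec, dotProduct_smul, smul_eq_mul, metricMatrix, mul_comm]
  have hs : star ψ ᵥ* (∑ J, u J • C'' J) = star ((∑ J, u J • C'' J)ᴴ *ᵥ ψ) := by
    rw [star_mulVec, conjTranspose_conjTranspose]
  rw [h1, h2, ← mulVec_mulVec, hA, mulVec_zero, dotProduct_zero, zero_add, ← mulVec_mulVec,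
    dotProduct_mulVec, hs, hB, star_zero, zero_dotProduct]

end Generic

/-! ## The sector kernel vectors of `T2′` -/

variable {Λ : Type*} [LinearOrder Λ] [Fintype Λ]

/-- `N̂_↑ ψ = a ψ` in the sector `(a, b)`. [folklore] -/
private theorem sum_numberOp_up_mulVec {a b : ℕ} {ψ : Fock (Orb Λ)} (hψ : IsInSector a b ψ) :
    (∑ y : Λ, numberOp y 0) *ᵥ ψ = (a : ℂ) • ψ := by
  funext s
  rw [Matrix.sum_mulVec, Finset.sum_apply, Pi.smul_apply, smul_eq_mul]
  simp only [LiebThm1.numberOp_eq_diagonal, mulVec_diagonal]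
  rw [← Finset.sum_mul, Finset.sum_boole]
  by_cases hs : (upPart s).card = a ∧ (downPart s).card = b
  · rw [← hs.1]; rfl
  · rw [hψ s hs, mul_zero, mul_zero]

/-- `N̂_↓ ψ = b ψ` in the sector `(a, b)`. [folklore] -/
private theorem sum_numberOp_down_mulVec {a b : ℕ} {ψ : Fock (Orb Λ)} (hψ : IsInSector a b ψ) :
    (∑ y : Λ, numberOp y 1) *ᵥ ψ = (b : ℂ) • ψ := by
  funext s
  rw [Matrix.sum_mulVec, Finset.sum_apply, Pi.smul_apply, smul_eq_mul]
  simp only [LiebThm1.numberOp_eq_diagonal, mulVec_diagonal]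
  rw [← Finset.sum_mul, Finset.sum_boole]
  by_cases hs : (upPart s).card = a ∧ (downPart s).card = b
  · rw [← hs.2]; rfl
  · rw [hψ s hs, mul_zero, mul_zero]

/-- `(b N̂_α − a N̂_β) ψ = 0` on the sector `(a, b)` — the operator `N̂′` of F2, cleared of its
denominator. -/
private theorem weightedNumber_mulVec_eq_zero {a b : ℕ} {ψ : Fock (Orb Λ)} (hψ : IsInSector a b ψ) :
    ((b : ℂ) • ∑ y : Λ, numberOp y 0 - (a : ℂ) • ∑ y : Λ, numberOp y 1) *ᵥ ψ = 0 := by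
  rw [sub_mulVec, Matrix.smul_mulVec, Matrix.smul_mulVec, sum_numberOp_up_mulVec hψ,
    sum_numberOp_down_mulVec hψ, smul_smul, smul_smul, mul_comm (b : ℂ) (a : ℂ), sub_self]

/-- `(b N̂_α − a N̂_β + b) a_{pα} ψ = 0` on the sector `(a, b)` (`a_{pα} ψ` lies in `(a − 1, b)`, or is `0`
when `a = 0`). -/
private theorem weightedNumber_annihilation_up_mulVec {a b : ℕ} {ψ : Fock (Orb Λ)}
    (hψ : IsInSector a b ψ) (p : Λ) :
    (((b : ℂ) • ∑ y : Λ, numberOp y 0 - (a : ℂ) • ∑ y : Λ, numberOp y 1 +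
        (b : ℂ) • (1 : Matrix (Finset (Orb Λ)) (Finset (Orb Λ)) ℂ)) * annihilation (orb p 0)) *ᵥ ψ = 0 := by
  rw [← mulVec_mulVec]
  cases a with
  | zero => rw [hψ.annihilation_up_mulVec_eq_zero p, mulVec_zero]
  | succ a' =>
    have h := hψ.annihilation_up_mulVec p
    rw [add_mulVec, sub_mulVec, Matrix.smul_mulVec, Matrix.smul_mulVec, Matrix.smul_mulVec, one_mulVec,
      sum_numberOp_up_mulVec h, sum_numberOp_down_mulVec h, smul_smul, smul_smul, ← sub_smul,
      ← add_smul]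
    push_cast
    ring_nf
    rw [zero_smul]

/-- The number operators are Hermitian: `(Σ_y n_{yσ})† = Σ_y n_{yσ}`. [folklore] -/
private theorem conjTranspose_sum_numberOp (σ : Fin 2) :
    (∑ y : Λ, numberOp y σ)ᴴ = ∑ y : Λ, numberOp y σ := by
  rw [conjTranspose_sum]
  refine Finset.sum_congr rfl fun y _ => ?_
  rw [numberOp, conjTranspose_mul, annihilation_conjTranspose, creation_conjTranspose]

/-- The adjoint of a cubic member: `(a†_i a†_j a_k)† = a†_k a_j a_i`. [folklore] -/
private theorem conjTranspose_twoCreateAnnihilate (i j k : Orb Λ) :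
    (twoCreateAnnihilate (i, j, k))ᴴ = creation k * annihilation j * annihilation i := by
  rw [twoCreateAnnihilate, conjTranspose_mul, conjTranspose_mul, annihilation_conjTranspose,
    creation_conjTranspose, creation_conjTranspose, Matrix.mul_assoc]

/-- `(a†_{pσ} a†_{qτ} a_{qτ})† = n_{qτ} a_{pσ}`. [folklore] -/
private theorem conjTranspose_twoCreateAnnihilate_diag (p q : Λ) (σ τ : Fin 2) :
    (twoCreateAnnihilate (orb p σ, orb q τ, orb q τ))ᴴ = numberOp q τ * annihilation (orb p σ) := by
  rw [conjTranspose_twoCreateAnnihilate]; rfl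

/-- The operator sum of F2 with the border: `Σ_q (b n_{q0} a_p − a n_{q1} a_p) + b a_p = (b N̂_α − a N̂_β + b) a_p`. -/
private theorem sum_weighted_numberOp_mul_add (x : Orb Λ) (cb ca : ℂ) :
    ∑ q : Λ, (cb • (numberOp q 0 * annihilation x) - ca • (numberOp q 1 * annihilation x)) +
        cb • annihilation x =
      (cb • ∑ y : Λ, numberOp y 0 - ca • ∑ y : Λ, numberOp y 1 +
        cb • (1 : Matrix (Finset (Orb Λ)) (Finset (Orb Λ)) ℂ)) * annihilation x := by
  rw [Matrix.add_mul, Matrix.sub_mul, Matrix.smul_mul, Matrix.smul_mul, Matrix.smul_mul, Matrix.one_mul,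
    Finset.sum_mul, Finset.sum_mul, Finset.smul_sum, Finset.smul_sum, Finset.sum_sub_distrib]

/-- The operator sum of F2 without the border: `Σ_q (b n_{q0} a_p − a n_{q1} a_p) = (b N̂_α − a N̂_β) a_p`. -/
private theorem sum_weighted_numberOp_mul (x : Orb Λ) (cb ca : ℂ) :
    ∑ q : Λ, (cb • (numberOp q 0 * annihilation x) - ca • (numberOp q 1 * annihilation x)) =
      (cb • ∑ y : Λ, numberOp y 0 - ca • ∑ y : Λ, numberOp y 1) * annihilation x := by
  rw [Matrix.sub_mul, Matrix.smul_mul, Matrix.smul_mul, Finset.sum_mul, Finset.sum_mul, Finset.smul_sum,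
    Finset.smul_sum, Finset.sum_sub_distrib]

/-- Collapsing the coefficient sum of `u_p` against any family `G` on triples:
`Σ_t (Σ_q (b[t = (i, q0, q0)] − a[t = (i, q1, q1)])) • G t = Σ_q (b • G(i,q0,q0) − a • G(i,q1,q1))`. -/
private theorem sum_kernelCoeff_smul {M : Type*} [AddCommGroup M] [Module ℂ M] (i : Orb Λ) (cb ca : ℂ)
    (G : Orb Λ × Orb Λ × Orb Λ → M) :
    ∑ t : Orb Λ × Orb Λ × Orb Λ,
        (∑ q : Λ, ((if t = (i, orb q 0, orb q 0) then cb else 0) -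
          (if t = (i, orb q 1, orb q 1) then ca else 0))) • G t =
      ∑ q : Λ, (cb • G (i, orb q 0, orb q 0) - ca • G (i, orb q 1, orb q 1)) := by
  simp only [Finset.sum_smul, sub_smul, ite_smul, zero_smul]
  rw [Finset.sum_comm]
  refine Finset.sum_congr rfl fun q _ => ?_
  rw [Finset.sum_sub_distrib, Finset.sum_ite_eq' Finset.univ (i, orb q 0, orb q 0),
    Finset.sum_ite_eq' Finset.univ (i, orb q 1, orb q 1)]
  simp

/-- **F2, spin `α` (state level): the border kernel vectors of `T2′`.** For every vector `ψ` of the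
`(N_α, N_β) = (a, b)` sector and every spatial orbital `p`, the vector `u_p` on the index set
`(Orb Λ)³ ⊔ Orb Λ` of the `T2′` matrix with `u_p(pα, qα, qα) = b`, `u_p(pα, qβ, qβ) = −a` (all `q`),
border `u_p(pα) = b`, and `0` elsewhere, is a kernel vector: `T2′(ψ) u_p = 0`
(rdm-A, FORMAT-qcl1 addendum 17, Theorem F2, operator form, multiplied through by `N_β`). -/
theorem t2Prime_mulVec_sectorKernel_up {a b : ℕ} {ψ : Fock (Orb Λ)} (hψ : IsInSector a b ψ) (p : Λ) :
    (metricMatrix (Sum.elim twoCreateAnnihilate creation) ψ +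
        (metricMatrix (Sum.elim (fun t : Orb Λ × Orb Λ × Orb Λ => (twoCreateAnnihilate t)ᴴ)
          (0 : Orb Λ → Matrix (Finset (Orb Λ)) (Finset (Orb Λ)) ℂ)) ψ)ᵀ) *ᵥ
      (Sum.elim
        (fun t : Orb Λ × Orb Λ × Orb Λ => ∑ q : Λ,
          ((if t = (orb p 0, orb q 0, orb q 0) then (b : ℂ) else 0) -
            (if t = (orb p 0, orb q 1, orb q 1) then (a : ℂ) else 0)))
        (fun l : Orb Λ => if l = orb p 0 then (b : ℂ) else 0)) = 0 := by
  have hcub : ∑ t : Orb Λ × Orb Λ × Orb Λ,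
      (∑ q : Λ, ((if t = (orb p 0, orb q 0, orb q 0) then (b : ℂ) else 0) -
        (if t = (orb p 0, orb q 1, orb q 1) then (a : ℂ) else 0))) • (twoCreateAnnihilate t)ᴴ =
      ∑ q : Λ, ((b : ℂ) • (numberOp q 0 * annihilation (orb p 0)) -
        (a : ℂ) • (numberOp q 1 * annihilation (orb p 0))) := by
    rw [sum_kernelCoeff_smul]
    simp only [conjTranspose_twoCreateAnnihilate_diag]
  refine metricMatrix_add_transpose_mulVec_eq_zero _ _ ψ _ ?_ ?_
  · -- Σ_J u_J C′_J† = (b N̂_α − a N̂_β + b) a_{pα}, which annihilates ψ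
    have hbor : ∑ l : Orb Λ, (if l = orb p 0 then (b : ℂ) else 0) • (creation l)ᴴ =
        (b : ℂ) • annihilation (orb p 0) := by
      simp only [ite_smul, zero_smul, Finset.sum_ite_eq', Finset.mem_univ, if_true, creation_conjTranspose]
    rw [Fintype.sum_sum_type]
    simp only [Sum.elim_inl, Sum.elim_inr]
    rw [hcub, hbor, sum_weighted_numberOp_mul_add]
    exact weightedNumber_annihilation_up_mulVec hψ p
  · -- (Σ_J u_J C″_J)† = a†_{pα} (b N̂_α − a N̂_β), which annihilates ψ
    rw [Fintype.sum_sum_type]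
    simp only [Sum.elim_inl, Sum.elim_inr, Pi.zero_apply, smul_zero, Finset.sum_const_zero, add_zero]
    rw [hcub, sum_weighted_numberOp_mul, conjTranspose_mul, annihilation_conjTranspose, conjTranspose_sub,
      conjTranspose_smul, conjTranspose_smul, conjTranspose_sum_numberOp, conjTranspose_sum_numberOp,
      ← mulVec_mulVec]
    have hs : star (b : ℂ) = (b : ℂ) := by simp
    have hs' : star (a : ℂ) = (a : ℂ) := by simp
    rw [hs, hs', weightedNumber_mulVec_eq_zero hψ, mulVec_zero]

/-! ### The spin-`β` twin -/

/-- `(a N̂_β − b N̂_α) ψ = 0` on the sector `(a, b)`. -/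
private theorem weightedNumber_down_mulVec_eq_zero {a b : ℕ} {ψ : Fock (Orb Λ)} (hψ : IsInSector a b ψ) :
    ((a : ℂ) • ∑ y : Λ, numberOp y 1 - (b : ℂ) • ∑ y : Λ, numberOp y 0) *ᵥ ψ = 0 := by
  rw [sub_mulVec, Matrix.smul_mulVec, Matrix.smul_mulVec, sum_numberOp_up_mulVec hψ,
    sum_numberOp_down_mulVec hψ, smul_smul, smul_smul, mul_comm (a : ℂ) (b : ℂ), sub_self]

/-- `(a N̂_β − b N̂_α + a) a_{pβ} ψ = 0` on the sector `(a, b)`. -/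
private theorem weightedNumber_annihilation_down_mulVec {a b : ℕ} {ψ : Fock (Orb Λ)}
    (hψ : IsInSector a b ψ) (p : Λ) :
    (((a : ℂ) • ∑ y : Λ, numberOp y 1 - (b : ℂ) • ∑ y : Λ, numberOp y 0 +
        (a : ℂ) • (1 : Matrix (Finset (Orb Λ)) (Finset (Orb Λ)) ℂ)) * annihilation (orb p 1)) *ᵥ ψ = 0 := by
  rw [← mulVec_mulVec]
  cases b with
  | zero => rw [hψ.annihilation_down_mulVec_eq_zero p, mulVec_zero]
  | succ b' =>
    have h := hψ.annihilation_down_mulVec p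
    rw [add_mulVec, sub_mulVec, Matrix.smul_mulVec, Matrix.smul_mulVec, Matrix.smul_mulVec, one_mulVec,
      sum_numberOp_up_mulVec h, sum_numberOp_down_mulVec h, smul_smul, smul_smul, ← sub_smul,
      ← add_smul]
    push_cast
    ring_nf
    rw [zero_smul]

/-- Border sum, spin `β`: `Σ_q (a n_{q1} a_x − b n_{q0} a_x) + a a_x = (a N̂_β − b N̂_α + a) a_x`. -/
private theorem sum_weighted_numberOp_mul_add' (x : Orb Λ) (ca cb : ℂ) :
    ∑ q : Λ, (ca • (numberOp q 1 * annihilation x) - cb • (numberOp q 0 * annihilation x)) +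
        ca • annihilation x =
      (ca • ∑ y : Λ, numberOp y 1 - cb • ∑ y : Λ, numberOp y 0 +
        ca • (1 : Matrix (Finset (Orb Λ)) (Finset (Orb Λ)) ℂ)) * annihilation x := by
  rw [Matrix.add_mul, Matrix.sub_mul, Matrix.smul_mul, Matrix.smul_mul, Matrix.smul_mul, Matrix.one_mul,
    Finset.sum_mul, Finset.sum_mul, Finset.smul_sum, Finset.smul_sum, Finset.sum_sub_distrib]

/-- Cubic sum, spin `β`: `Σ_q (a n_{q1} a_x − b n_{q0} a_x) = (a N̂_β − b N̂_α) a_x`. -/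
private theorem sum_weighted_numberOp_mul' (x : Orb Λ) (ca cb : ℂ) :
    ∑ q : Λ, (ca • (numberOp q 1 * annihilation x) - cb • (numberOp q 0 * annihilation x)) =
      (ca • ∑ y : Λ, numberOp y 1 - cb • ∑ y : Λ, numberOp y 0) * annihilation x := by
  rw [Matrix.sub_mul, Matrix.smul_mul, Matrix.smul_mul, Finset.sum_mul, Finset.sum_mul, Finset.smul_sum,
    Finset.smul_sum, Finset.sum_sub_distrib]

/-- Collapsing the coefficient sum of the spin-`β` vector against any family `G` on triples. -/
private theorem sum_kernelCoeff_smul' {M : Type*} [AddCommGroup M] [Module ℂ M] (i : Orb Λ) (ca cb : ℂ)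
    (G : Orb Λ × Orb Λ × Orb Λ → M) :
    ∑ t : Orb Λ × Orb Λ × Orb Λ,
        (∑ q : Λ, ((if t = (i, orb q 1, orb q 1) then ca else 0) -
          (if t = (i, orb q 0, orb q 0) then cb else 0))) • G t =
      ∑ q : Λ, (ca • G (i, orb q 1, orb q 1) - cb • G (i, orb q 0, orb q 0)) := by
  simp only [Finset.sum_smul, sub_smul, ite_smul, zero_smul]
  rw [Finset.sum_comm]
  refine Finset.sum_congr rfl fun q _ => ?_
  rw [Finset.sum_sub_distrib, Finset.sum_ite_eq' Finset.univ (i, orb q 1, orb q 1),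
    Finset.sum_ite_eq' Finset.univ (i, orb q 0, orb q 0)]
  simp

/-- **F2, spin `β` (state level).** For every vector `ψ` of the `(a, b)` sector and every spatial
orbital `p`, the vector with `u_p(pβ, qβ, qβ) = a`, `u_p(pβ, qα, qα) = −b` (all `q`), border
`u_p(pβ) = a`, `0` elsewhere, satisfies `T2′(ψ) u_p = 0` (rdm-A Theorem F2, `σ = β`, times `N_α`). -/
theorem t2Prime_mulVec_sectorKernel_down {a b : ℕ} {ψ : Fock (Orb Λ)} (hψ : IsInSector a b ψ) (p : Λ) :
    (metricMatrix (Sum.elim twoCreateAnnihilate creation) ψ +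
        (metricMatrix (Sum.elim (fun t : Orb Λ × Orb Λ × Orb Λ => (twoCreateAnnihilate t)ᴴ)
          (0 : Orb Λ → Matrix (Finset (Orb Λ)) (Finset (Orb Λ)) ℂ)) ψ)ᵀ) *ᵥ
      (Sum.elim
        (fun t : Orb Λ × Orb Λ × Orb Λ => ∑ q : Λ,
          ((if t = (orb p 1, orb q 1, orb q 1) then (a : ℂ) else 0) -
            (if t = (orb p 1, orb q 0, orb q 0) then (b : ℂ) else 0)))
        (fun l : Orb Λ => if l = orb p 1 then (a : ℂ) else 0)) = 0 := by
  have hcub : ∑ t : Orb Λ × Orb Λ × Orb Λ,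
      (∑ q : Λ, ((if t = (orb p 1, orb q 1, orb q 1) then (a : ℂ) else 0) -
        (if t = (orb p 1, orb q 0, orb q 0) then (b : ℂ) else 0))) • (twoCreateAnnihilate t)ᴴ =
      ∑ q : Λ, ((a : ℂ) • (numberOp q 1 * annihilation (orb p 1)) -
        (b : ℂ) • (numberOp q 0 * annihilation (orb p 1))) := by
    rw [sum_kernelCoeff_smul']
    simp only [conjTranspose_twoCreateAnnihilate_diag]
  refine metricMatrix_add_transpose_mulVec_eq_zero _ _ ψ _ ?_ ?_
  · have hbor : ∑ l : Orb Λ, (if l = orb p 1 then (a : ℂ) else 0) • (creation l)ᴴ =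
        (a : ℂ) • annihilation (orb p 1) := by
      simp only [ite_smul, zero_smul, Finset.sum_ite_eq', Finset.mem_univ, if_true, creation_conjTranspose]
    rw [Fintype.sum_sum_type]
    simp only [Sum.elim_inl, Sum.elim_inr]
    rw [hcub, hbor, sum_weighted_numberOp_mul_add']
    exact weightedNumber_annihilation_down_mulVec hψ p
  · rw [Fintype.sum_sum_type]
    simp only [Sum.elim_inl, Sum.elim_inr, Pi.zero_apply, smul_zero, Finset.sum_const_zero, add_zero]
    rw [hcub, sum_weighted_numberOp_mul', conjTranspose_mul, annihilation_conjTranspose, conjTranspose_sub,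
      conjTranspose_smul, conjTranspose_smul, conjTranspose_sum_numberOp, conjTranspose_sum_numberOp,
      ← mulVec_mulVec]
    have hs : star (b : ℂ) = (b : ℂ) := by simp
    have hs' : star (a : ℂ) = (a : ℂ) := by simp
    rw [hs, hs', weightedNumber_down_mulVec_eq_zero hψ, mulVec_zero]

end Summit.Ventures.CertifiedQuantumChemistry

end
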